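import Literature.Topology.FourManifolds.SphereSurgeryStep
import Literature.AlgebraicTopology.SingularHomology.LocalHomologyOfSetTransfer
import Literature.AlgebraicTopology.SingularHomology.ClopenAdditivity
import Literature.AlgebraicTopology.SingularHomology.BoundaryComplementHomology
import HarnessLib

/-!
# Surgery on a primitive isotropic family of middle-dimensional spheres (Kervaire–Milnor, Lemma 7.1)

Topic `Literature/Topology/FourManifolds` (fact seat of
`Literature.Topology.FourManifolds.HomotopySphere.mk_eq_mk_iff_sigmaGen_dvd_sub`, Kervaire–Milnor's
Thm. 7.5; the companion `SphereSurgeryHomology.lean` treats surgery *below* the middle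
dimension).  M. Kervaire, J. Milnor, *Groups of homotopy spheres I*, Ann. of Math. 77 (1963),
**Lemma 7.1** (pp. 526–528): *let `M` be a `(k-1)`-connected manifold of dimension `2k`, `k ≥ 3`,
and suppose that `HₖM` is free abelian with basis `{λ₁, …, λᵣ, μ₁, …, μᵣ}` where `λᵢ·λⱼ = 0`,
`λᵢ·μⱼ = δᵢⱼ`; suppose further that every imbedded sphere in `M` which represents a
homology class in the subgroup generated by `λ₁, …, λᵣ` has trivial normal bundle. Then `HₖM`
can be killed by a sequence of spherical modifications.*  The printed proof (p. 527) represents `λᵣ` by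
an embedded sphere `φ : Sᵏ × Dᵏ → M` ([17, Lemma 6], Haefliger), forms `M' = χ(M, φ)` and
`M₀ = M - Int φ(Sᵏ × Dᵏ) = M' - Int φ'(Dᵏ⁺¹ × Sᵏ⁻¹)`, and computes: *"Since `μᵣ·λᵣ = 1` it
follows that `Hₖ₋₁M₀ = 0`. From this fact one easily proves that `M₀` and `M'` are
`(k-1)`-connected. The group `HₖM₀` is isomorphic to the subgroup of `HₖM` generated by
`{λ₁, …, λᵣ, μ₁, …, μᵣ₋₁}`. The group `HₖM'` is isomorphic to a quotient group of `HₖM₀`. It has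
basis `{λ'₁, …, λ'ᵣ₋₁, μ'₁, …, μ'ᵣ₋₁}`"*, and iterates `r` times (p. 528).  A. Kosinski,
*Differential Manifolds* (1993), X.3, proof of Thm. (3.4), argues the same way ("Since
`e₁·f₁ = 1`, `S` is primitive … by 1.3 `χ(M, S)` is `(2n-1)`-connected, and the rank of
`H₂ₙ(χ(M, S))` is smaller").

This file PROVES the homological and `π₁` content of that argument, for the **simultaneous**
surgery `χ(X, φ₁, …, φᵣ)` along a finite disjoint framed family (Milnor 1965, Def. 3.11 and §3
p. 21; the tree's `FramedSphereFamily`, `FramedSphereFamily.Surgered`), in the relational language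
of `SphereSurgeryHomology.lean`: `P = jA(X ∖ ⋃ Sᵢ) ∪ jB(ι × OD^{k+1} × Sˡ)` glued along Milnor's
identification, unbundled as `hA hB hcov hrel`.  The geometric hypotheses of Lemma 7.1 enter only
through two homological conditions on the family of core spheres `Sᵢ = φᵢ(Sᵏ × 0)`, `k = l + 1`,
in a space `X` of "dimension" `2l + 2`:

* **primitivity** (`λᵢ·μⱼ = δᵢⱼ`: dual classes realise the local classes at the spheres):
  `ρ : H_{l+1}(X) → H_{l+1}(X | ⋃ Sᵢ)` is onto;
* **isotropy** (`λᵢ·λⱼ = 0` for a basis `{λᵢ, μⱼ}`: a class meeting no sphere is a combination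
  of the spheres): `ker ρ ⊆ span {(Sᵢ)_* H_{l+1}(S^{l+1})}`.

Main results (all proved; coefficients in any module `M` over a commutative ring `R`):

* `FramedSphereFamily.isZero_singularHomology_of_surgery_middle` — **`H_{l+1}(P; M) = 0` under
  isotropy** (Kervaire–Milnor's "`HₖM'` is a quotient of `HₖM₀`", with the cosets of the `λᵢ`
  killed): `(jA)_*` is onto in degree `l + 1` since the cocores `S'ᵢ = jB(i, 0, Sˡ)` have product
  neighbourhoods of fibre dimension `l + 2` (`isZero_localHomologyOfSet_coCores`,
  `epi_map_jA_codim`); a class of `X ∖ ⋃ Sᵢ` maps into `ker ρ`, hence is, in `X`, a combination of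
  sphere classes, which lift to parallel spheres in the punctured unit tubes; the difference dies
  in `X`, so it comes from
  `H_{l+2}(X | ⋃ Sᵢ) ≅ H_{l+2}(O | K₀)` for the unit tube model `O = ι × Sᵏ × Bˡ⁺¹`
  (excision along an open embedding, `isIso_relMap_of_isOpenEmbedding`, and naturality of `∂`),
  i.e. again from the punctured unit tubes; and these map into the handles `ι × OD^{k+1} × Sˡ`,
  whose `H_{l+1}` vanishes (`isZero_singularHomology_ballTimesSphere_of_ne`, additivity over the
  index, Hatcher Prop. 2.6).  No Künneth formula, Thom class or Poincaré duality is used.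
* `FramedSphereFamily.isZero_singularHomology_of_surgery_of_le` — **`H_q(P; M) = 0` for
  `0 < q ≤ l` under primitivity** ("`Hₖ₋₁M₀ = 0` … `M₀` and `M'` are `(k-1)`-connected"):
  `H_q(P) ≅ H_q(X ∖ ⋃ Sᵢ)` (`isIso_map_jA_of_lt`), which is `H_q(X)` for `q < l`
  (`isIso_map_subsetIncl_compl_cores`) and vanishes for `q = l` by exactness of
  `H_{l+1}(X) →ρ H_{l+1}(X | ⋃ Sᵢ) →∂ H_l(X ∖ ⋃ Sᵢ) → H_l(X) = 0`
  (`isZero_singularHomology_compl_cores_of_surjective`).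
* `FramedSphereFamily.simplyConnectedSpace_of_surgery_family` — `P` is simply connected if `X`
  is (`k, l ≥ 2`): the iterated van Kampen statement
  `simplyConnectedSpace_compl_iUnion_core_iff` (finitely many disjoint tube cores with simply
  connected punctured fibre, from the tree's `VanKampen.simplyConnectedSpace_compl_core_iff`)
  applied to the cores in `X` and to the cocores in `P` (`compl_iUnion_coCore_eq_range`:
  `P ∖ ⋃ S'ᵢ = jA(X ∖ ⋃ Sᵢ)`), with `pathConnectedSpace_of_surgery_family`.
* `FramedSphereFamily.isZero_singularHomology_surgered_middle`, `…_surgered_of_le`,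
  `simplyConnectedSpace_surgered_family` — the same for the surgered manifold `ν.Surgered hkl` of
  the tree (`SphereFamilySurgeryExistence.lean`), any finite nonempty index type.

Supporting generalities (proved): `isZero_localHomologyOfSet_iUnion_of_disjoint` (local homology
along a finite disjoint union of closed sets), `isIso_relMap_of_isOpenEmbedding` (excision for the
map of pairs along an open embedding), `FramedSphereFamily.isOpenEmbedding_tubes`
(`ι × Sᵏ × ℝˡ⁺¹ → X` is an open embedding), `isZero_localHomologyOfSet_cores`,
`exists_coTubes` (the product neighbourhoods of the cocores).  Everything is a theorem: no new
named notions, no named facts (the unit tube model and the map to the handles are local to the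
proof of the main theorem).  Spaces live in `Type` as in `SphereSurgeryHomology.lean`.

Deviation from the printed line: Kervaire–Milnor modify one sphere at a time and carry the
basis `{λ'ᵢ, μ'ⱼ}` of `HₖM'` along ("the intersection numbers in `M'` are the same as those in
`M`"); here the `r` disjoint spheres are removed at once (Milnor 1965, §3 p. 21), which needs no
bookkeeping of intersection numbers in `M'` — the two homological hypotheses are used once, in
`X`.  The geometric half of Lemma 7.1 (representing `λ₁, …, λᵣ` by disjoint framed embedded
spheres with these two properties: [17, Lemmas 6–7], Haefliger, Whitney) is not addressed here.

## References

* M. Kervaire, J. Milnor, *Groups of homotopy spheres I*, Ann. of Math. 77 (1963), 504–537: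
  Lemma 7.1 and its proof (pp. 526–528), Lemma 5.6 (p. 515). doi:10.2307/1970128
  [KervaireMilnorAnnals1963]
* A. Kosinski, *Differential Manifolds* (1993), Ch. X §1 Prop. (1.1), (1.3), §2 Thm. (2.2)
  (proof, p. 201), §3 Thm. (3.4) (proof, p. 205). [Kosinski1993]
* J. Milnor, *Lectures on the h-cobordism theorem* (1965), Def. 3.11 (PDF p. 17), §3 p. 21.
  [MilnorHCobordism1965]
* J. Milnor, *A procedure for killing the homotopy groups of differentiable manifolds*, Proc.
  Sympos. Pure Math. III (1961), 39–55, p. 54 and Lemmas 6, 7. [MilnorKilling1961]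
* A. Hatcher, *Algebraic Topology* (2002), Prop. 2.6, §2.1 Thm. 2.16 and naturality of `∂`,
  Thm. 2.20, §2.2 p. 152, Lemma 1.15. [HatcherAT2002]
-/

noncomputable section

open scoped Manifold ContDiff Topology ContinuousMap
open CategoryTheory Limits Set Function Metric Topology
open Literature.AlgebraicTopology.SingularHomology
open Literature.AlgebraicTopology.FundamentalGroup

universe u v

namespace Literature.Topology.FourManifolds

variable (R : Type v) [CommRing R] (M : Type v) [AddCommGroup M] [Module R M]

/-! ### §1 Generalities -/

section LocalUnion

variable {X : Type u} [TopologicalSpace X]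

/-- **Local homology along a finite disjoint union of closed sets**: if the closed sets `K i`
(`i` in a finite set `s`) are pairwise disjoint and `H_q(X | K i; M) = 0` for all `i ∈ s`, then
`H_q(X | ⋃_{i ∈ s} K i; M) = 0` (relative Mayer–Vietoris with empty intersections, Hatcher 2002,
§2.2 p. 152). [cite: HatcherAT2002, §2.2 p. 152] -/
theorem isZero_localHomologyOfSet_biUnion_of_disjoint {ι : Type*} (K : ι → Set X)
    (hK : ∀ i, IsClosed (K i)) (hdisj : Pairwise (Disjoint on K)) (q : ℕ) (s : Finset ι)
    (h0 : ∀ i ∈ s, IsZero (localHomologyOfSet R M X (K i) q)) :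
    IsZero (localHomologyOfSet R M X (⋃ i ∈ s, K i) q) := by
  classical
  induction s using Finset.induction_on with
  | empty =>
    have he : (⋃ i ∈ (∅ : Finset ι), K i) = (∅ : Set X) := by simp
    rw [he]
    exact isZero_localHomologyOfSet_empty R M q
  | insert j s hj ih =>
    have hunion : (⋃ i ∈ insert j s, K i) = K j ∪ ⋃ i ∈ s, K i := by
      rw [Finset.set_biUnion_insert]
    rw [hunion]
    have hsc : IsClosed (⋃ i ∈ s, K i) := isClosed_biUnion_finset fun i _ ↦ hK i
    have hinter : K j ∩ (⋃ i ∈ s, K i) = ∅ := by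
      refine Set.eq_empty_of_forall_notMem fun x ⟨hxj, hxs⟩ ↦ ?_
      obtain ⟨i, hi, hxi⟩ := Set.mem_iUnion₂.1 hxs
      have hij : j ≠ i := fun h ↦ hj (h ▸ hi)
      exact Set.disjoint_left.1 (hdisj hij) hxj hxi
    have hz : IsZero (localHomologyOfSet R M X (K j ∩ ⋃ i ∈ s, K i) (q + 1)) := by
      rw [hinter]
      exact isZero_localHomologyOfSet_empty R M (q + 1)
    refine localHomologyOfSet.isZero_localHomologyOfSet_union R M (hK j) hsc q
      (h0 j (Finset.mem_insert_self j s))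
      (ih fun i hi ↦ h0 i (Finset.mem_insert_of_mem hi)) fun y ↦ ⟨0, ?_⟩
    haveI := ModuleCat.subsingleton_of_isZero hz
    exact Subsingleton.elim _ _

/-- Local homology along a finite disjoint union of closed sets with vanishing local homology
vanishes (the whole index type). [cite: HatcherAT2002, §2.2 p. 152] -/
theorem isZero_localHomologyOfSet_iUnion_of_disjoint {ι : Type*} [Fintype ι] (K : ι → Set X)
    (hK : ∀ i, IsClosed (K i)) (hdisj : Pairwise (Disjoint on K)) (q : ℕ)
    (h0 : ∀ i, IsZero (localHomologyOfSet R M X (K i) q)) :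
    IsZero (localHomologyOfSet R M X (⋃ i, K i) q) := by
  have h := isZero_localHomologyOfSet_biUnion_of_disjoint R M K hK hdisj q Finset.univ
    fun i _ ↦ h0 i
  have he : (⋃ i ∈ (Finset.univ : Finset ι), K i) = ⋃ i, K i := by simp
  rwa [he] at h

end LocalUnion

/-! ### Excision along an open embedding for a map of pairs -/

section RelExcision

variable {O Y : Type u} [TopologicalSpace O] [TopologicalSpace Y]

/-- A homeomorphism of pairs induces an isomorphism on relative homology. [folklore] -/
theorem isIso_relMap_homeomorph (e : O ≃ₜ Y) {A : Set O} {B : Set Y} (hAB : Set.MapsTo e A B)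
    (hBA : Set.MapsTo e.symm B A) (q : ℕ) :
    IsIso (relativeSingularHomology.map R M (e : C(O, Y)) hAB q) := by
  refine ⟨⟨relativeSingularHomology.map R M (e.symm : C(Y, O)) hBA q, ?_, ?_⟩⟩
  · rw [← relativeSingularHomology.map_comp]
    have h : (e.symm : C(Y, O)).comp (e : C(O, Y)) = ContinuousMap.id O := by
      ext x; exact e.symm_apply_apply x
    have : relativeSingularHomology.map R M ((e.symm : C(Y, O)).comp (e : C(O, Y)))
        (hBA.comp hAB) q = relativeSingularHomology.map R M (ContinuousMap.id O)
        (Set.mapsTo_id A) q := by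
      congr 1
    rw [this, relativeSingularHomology.map_id]
  · rw [← relativeSingularHomology.map_comp]
    have h : (e : C(O, Y)).comp (e.symm : C(Y, O)) = ContinuousMap.id Y := by
      ext x; exact e.apply_symm_apply x
    have : relativeSingularHomology.map R M ((e : C(O, Y)).comp (e.symm : C(Y, O)))
        (hAB.comp hBA) q = relativeSingularHomology.map R M (ContinuousMap.id Y)
        (Set.mapsTo_id B) q := by
      congr 1
    rw [this, relativeSingularHomology.map_id]

/-- **Excision along an open embedding, for the map of pairs**: for an open embedding
`κ : O → Y` and `K ⊆ O` with `κ K` closed, the map of pairs `(O, O ∖ K) → (Y, Y ∖ κ K)` induces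
isomorphisms `H_q(O | K; M) ≅ H_q(Y | κ K; M)` (homeomorphism onto the open range, then excision
of the closed set `Y ∖ range κ`, Hatcher 2002, Thm. 2.20). [cite: HatcherAT2002, Thm. 2.20] -/
theorem isIso_relMap_of_isOpenEmbedding {κ : O → Y} (hκ : IsOpenEmbedding κ) {K : Set O}
    (hK : IsClosed (κ '' K)) (h : Set.MapsTo κ Kᶜ (κ '' K)ᶜ) (q : ℕ) :
    IsIso (relativeSingularHomology.map R M ⟨κ, hκ.continuous⟩ h q) := by
  let η : O ≃ₜ ↥(range κ) := hκ.isEmbedding.toHomeomorph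
  have hηv : ∀ o, ((η o : ↥(range κ)) : Y) = κ o := fun _ ↦ rfl
  have hAB : Set.MapsTo η Kᶜ ((Subtype.val ⁻¹' (κ '' K))ᶜ : Set ↥(range κ)) := by
    intro o ho hmem
    apply ho
    have hmem' : κ o ∈ κ '' K := hmem
    obtain ⟨o', ho', he⟩ := hmem'
    rwa [← hκ.injective he]
  have hBA : Set.MapsTo η.symm ((Subtype.val ⁻¹' (κ '' K))ᶜ : Set ↥(range κ)) Kᶜ := by
    intro y hy hmem
    apply hy
    show (y : Y) ∈ κ '' K
    have : κ (η.symm y) = (y : Y) := by rw [← hηv, η.apply_symm_apply]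
    rw [← this]
    exact Set.mem_image_of_mem κ hmem
  haveI h1 := isIso_relMap_homeomorph R M η hAB hBA q
  haveI h2 := localHomologyOfSet.isIso_map_subsetIncl_of_isClosed R M hκ.isOpen_range hK
    (image_subset_range κ K) q
  have hfac : relativeSingularHomology.map R M ⟨κ, hκ.continuous⟩ h q =
      relativeSingularHomology.map R M (η : C(O, ↥(range κ))) hAB q ≫
        relativeSingularHomology.map R M (subsetIncl (range κ))
          (localHomologyOfSet.mapsTo_val_compl (range κ) (κ '' K)) q := by
    rw [← relativeSingularHomology.map_comp]
    congr 1
  rw [hfac]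
  infer_instance

end RelExcision

/-! ### `π₁` of the complement of finitely many disjoint cores (van Kampen, iterated) -/

section PiOneFamily

open Literature.AlgebraicTopology.FundamentalGroup.VanKampen

variable {Z E W : Type*} [TopologicalSpace Z] [CompactSpace Z] [PathConnectedSpace Z] [Nonempty Z]
  [NormedAddCommGroup E] [SimplyConnectedSpace E] [SimplyConnectedSpace ↥(({0} : Set E)ᶜ)]
  [TopologicalSpace W] [T2Space W]

/-- **Removing finitely many disjoint tube cores with simply connected punctured fibre does
not change simple connectivity** (Kosinski 1993, X.2, proof of (2.2), iterated): for open
embeddings `φᵢ : Z × E → W` (`i` in a finite set `s`) with pairwise disjoint ranges, `Z` compact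
path connected, `W` Hausdorff path connected, `E` and `E ∖ 0` simply connected, the complement
`W ∖ ⋃_{i ∈ s} φᵢ(Z × 0)` is path connected, and it is simply connected iff `W` is
(`VanKampen.simplyConnectedSpace_compl_core_iff`, one core at a time).
[cite: Kosinski1993, Ch. X §2, Thm. 2.2 (proof)] -/
theorem pathConnected_and_simplyConnectedSpace_compl_biUnion_core_iff [PathConnectedSpace W]
    {ι : Type*} (φ : ι → Z × E → W) (hφ : ∀ i, IsOpenEmbedding (φ i))
    (hdisj : Pairwise (Disjoint on fun i ↦ range (φ i))) (s : Finset ι) :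
    PathConnectedSpace ↥(⋃ i ∈ s, φ i '' (univ ×ˢ ({0} : Set E)))ᶜ ∧
      (SimplyConnectedSpace ↥(⋃ i ∈ s, φ i '' (univ ×ˢ ({0} : Set E)))ᶜ ↔
        SimplyConnectedSpace W) := by
  classical
  induction s using Finset.induction_on with
  | empty =>
    have he : (⋃ i ∈ (∅ : Finset ι), φ i '' (univ ×ˢ ({0} : Set E)))ᶜ = (univ : Set W) := by simp
    rw [he]
    let e : ↥(univ : Set W) ≃ₜ W := Homeomorph.Set.univ W
    exact ⟨e.symm.surjective.pathConnectedSpace e.symm.continuous,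
      e.toHomotopyEquiv.simplyConnectedSpace_iff⟩
  | insert j s hj ih =>
    obtain ⟨hpc, hsc⟩ := ih
    -- the ambient space `W' = W ∖ ⋃_{i ∈ s} cores` and the tube `φ j` inside it
    set U : Set W := (⋃ i ∈ s, φ i '' (univ ×ˢ ({0} : Set E)))ᶜ with hU
    haveI : PathConnectedSpace ↥U := hpc
    have hmemU : ∀ q, φ j q ∈ U := by
      intro q hq
      obtain ⟨i, hi, hqi⟩ := Set.mem_iUnion₂.1 hq
      obtain ⟨q', -, he⟩ := hqi
      have hij : i ≠ j := fun h ↦ hj (h ▸ hi)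
      exact Set.disjoint_left.1 (hdisj hij) (mem_range_self q') (he ▸ mem_range_self q)
    let φ' : Z × E → ↥U := fun q ↦ ⟨φ j q, hmemU q⟩
    have hφ' : IsOpenEmbedding φ' := by
      refine IsOpenEmbedding.of_continuous_injective_isOpenMap ((hφ j).continuous.subtype_mk _)
        (fun a b h ↦ (hφ j).injective (congrArg Subtype.val h)) fun V hV ↦ ?_
      have : φ' '' V = Subtype.val ⁻¹' (φ j '' V) := by
        ext x
        constructor
        · rintro ⟨q, hq, rfl⟩; exact ⟨q, hq, rfl⟩
        · rintro ⟨q, hq, he⟩; exact ⟨q, hq, Subtype.ext he⟩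
      rw [this]
      exact ((hφ j).isOpenMap V hV).preimage continuous_subtype_val
    -- the new complement is `U ∖ core j`
    set S' : Set ↥U := φ' '' (univ ×ˢ ({0} : Set E)) with hS'
    have hval : U ∩ (Subtype.val '' S')ᶜ =
        (⋃ i ∈ insert j s, φ i '' (univ ×ˢ ({0} : Set E)))ᶜ := by
      rw [Finset.set_biUnion_insert, Set.compl_union, Set.inter_comm]
      congr 1
      rw [hS', ← Set.image_comp]
      rfl
    let e₁ : ↥(S'ᶜ) ≃ₜ ↥(U ∩ (Subtype.val '' S')ᶜ) :=
      { toFun := fun x ↦ ⟨x.1.1, x.1.2, fun h ↦ by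
          obtain ⟨y, hy, he⟩ := h
          have : y = x.1 := Subtype.ext he
          exact x.2 (this ▸ hy)⟩
        invFun := fun y ↦ ⟨⟨y.1, y.2.1⟩, fun h ↦ y.2.2 ⟨⟨y.1, y.2.1⟩, h, rfl⟩⟩
        left_inv := fun _ ↦ rfl
        right_inv := fun _ ↦ rfl
        continuous_toFun := (continuous_subtype_val.comp continuous_subtype_val).subtype_mk _
        continuous_invFun := (continuous_subtype_val.subtype_mk _).subtype_mk _ }
    let e : ↥(S'ᶜ) ≃ₜ ↥(⋃ i ∈ insert j s, φ i '' (univ ×ˢ ({0} : Set E)))ᶜ :=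
      e₁.trans (Homeomorph.setCongr hval)
    -- path-connectedness of `U ∖ core j` (reroute through the punctured tube)
    have hUpc : IsPathConnected (S'ᶜ) := by
      have hUT := (image_compl_zero_eq (Z := Z) (E := E) hφ'.injective).symm
      refine isPathConnected_compl_of_nbhd (isClosed_image_core hφ'.continuous) hφ'.isOpen_range
        (image_subset_range _ _) isPathConnected_univ ?_
      rw [sdiff_eq, inter_comm, hUT]
      refine IsPathConnected.image ?_ hφ'.continuous
      have : {q : Z × E | q.2 ∈ (({0} : Set E)ᶜ)} = univ ×ˢ ({0}ᶜ : Set E) := by ext q; simp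
      rw [this]
      exact isPathConnected_univ.prod (isPathConnected_iff_pathConnectedSpace.2 inferInstance)
    haveI : PathConnectedSpace ↥(S'ᶜ) := isPathConnected_iff_pathConnectedSpace.1 hUpc
    refine ⟨e.surjective.pathConnectedSpace e.continuous, ?_⟩
    rw [← e.toHomotopyEquiv.simplyConnectedSpace_iff, simplyConnectedSpace_compl_core_iff hφ']
    exact hsc

/-- **Removing finitely many disjoint tube cores with simply connected punctured fibre does not
change simple connectivity** (whole index type). [cite: Kosinski1993, Ch. X §2, Thm. 2.2 (proof)] -/
theorem simplyConnectedSpace_compl_iUnion_core_iff [PathConnectedSpace W] {ι : Type*} [Fintype ι]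
    (φ : ι → Z × E → W) (hφ : ∀ i, IsOpenEmbedding (φ i))
    (hdisj : Pairwise (Disjoint on fun i ↦ range (φ i))) :
    SimplyConnectedSpace ↥(⋃ i, φ i '' (univ ×ˢ ({0} : Set E)))ᶜ ↔ SimplyConnectedSpace W := by
  have h := (pathConnected_and_simplyConnectedSpace_compl_biUnion_core_iff φ hφ hdisj
    Finset.univ).2
  have he : (⋃ i ∈ (Finset.univ : Finset ι), φ i '' (univ ×ˢ ({0} : Set E))) =
      ⋃ i, φ i '' (univ ×ˢ ({0} : Set E)) := by simp
  rwa [he] at h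

/-- The complement of finitely many disjoint tube cores in a path-connected space is path
connected. [cite: Kosinski1993, Ch. X §2, Thm. 2.2 (proof)] -/
theorem pathConnectedSpace_compl_iUnion_core [PathConnectedSpace W] {ι : Type*} [Fintype ι]
    (φ : ι → Z × E → W) (hφ : ∀ i, IsOpenEmbedding (φ i))
    (hdisj : Pairwise (Disjoint on fun i ↦ range (φ i))) :
    PathConnectedSpace ↥(⋃ i, φ i '' (univ ×ˢ ({0} : Set E)))ᶜ := by
  have h := (pathConnected_and_simplyConnectedSpace_compl_biUnion_core_iff φ hφ hdisj
    Finset.univ).1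
  have he : (⋃ i ∈ (Finset.univ : Finset ι), φ i '' (univ ×ˢ ({0} : Set E))) =
      ⋃ i, φ i '' (univ ×ˢ ({0} : Set E)) := by simp
  rwa [he] at h

end PiOneFamily

/-! ### §2 Framed families: the tubes as one open embedding, the homology of the handles -/

section Family

variable {EX HX : Type*} [NormedAddCommGroup EX] [NormedSpace ℝ EX] [TopologicalSpace HX]
  {IX : ModelWithCorners ℝ EX HX} {X : Type} [TopologicalSpace X] [ChartedSpace HX X]
  {ι : Type} {k l : ℕ} (ν : FramedSphereFamily IX X ι k (l + 1))

namespace FramedSphereFamily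

/-- The core sphere is the image of the zero section of the tube. [folklore] -/
theorem range_sphere_eq (i : ι) : range (ν.sphere i) = ν.toFun i '' (univ ×ˢ ({0} : Set (EuclideanSpace ℝ (Fin (l + 1))))) := by
  ext x
  simp only [mem_range, sphere_apply, mem_image, mem_prod, mem_univ, true_and, mem_singleton_iff,
    Prod.exists]
  constructor
  · rintro ⟨v, rfl⟩; exact ⟨v, 0, rfl, rfl⟩
  · rintro ⟨v, w, rfl, rfl⟩; exact ⟨v, rfl⟩

/-- The union of the cores as a union of images of zero sections. [folklore] -/
theorem cores_eq_iUnion : ν.cores = ⋃ i, ν.toFun i '' (univ ×ˢ ({0} : Set (EuclideanSpace ℝ (Fin (l + 1))))) := by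
  simp only [cores, range_sphere_eq]

/-- The images of the zero sections of distinct tubes are disjoint. [folklore] -/
theorem pairwise_disjoint_image_core :
    Pairwise (Disjoint on fun i ↦ ν.toFun i '' (univ ×ˢ ({0} : Set (EuclideanSpace ℝ (Fin (l + 1)))))) := fun _ _ h ↦
  (ν.disjoint_range h).mono (image_subset_range _ _) (image_subset_range _ _)

/-- **All the tubes at once form an open embedding** `ι × Sᵏ × ℝˡ⁺¹ → X`, `(i, q) ↦ φᵢ q` (disjoint
open embeddings over a discrete index). [folklore] -/
theorem isOpenEmbedding_tubes : IsOpenEmbedding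
    (fun p : DiscreteIndex ι × (((Metric.sphere (0 : EuclideanSpace ℝ (Fin (k + 1))) 1)) × (EuclideanSpace ℝ (Fin (l + 1)))) ↦ ν.toFun (DiscreteIndex.mk.symm p.1) p.2) := by
  refine IsOpenEmbedding.of_continuous_injective_isOpenMap ?_ ?_ ?_
  · exact continuous_prod_of_discrete_left.2 fun i ↦ ν.continuous _
  · rintro ⟨i, q⟩ ⟨j, q'⟩ h
    simp only at h
    by_cases hij : DiscreteIndex.mk.symm i = DiscreteIndex.mk.symm j
    · have hij' : i = j := DiscreteIndex.mk.symm.injective hij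
      subst hij'
      rw [ν.injective _ h]
    · exact (ν.apply_ne_apply hij q q' h).elim
  · exact isOpenMap_prod_of_discrete_left.2 fun i ↦ (ν.isOpenEmbedding_toFun _).isOpenMap

/-- **The open unit tubes at once form an open embedding** `O = ι × Sᵏ × Bˡ⁺¹ → X` (the unit tube
model). [folklore] -/
theorem isOpenEmbedding_unitTubes : IsOpenEmbedding
    (fun p : DiscreteIndex ι × (((Metric.sphere (0 : EuclideanSpace ℝ (Fin (k + 1))) 1)) × ↥(ball (0 : EuclideanSpace ℝ (Fin (l + 1))) 1)) ↦
      ν.toFun (DiscreteIndex.mk.symm p.1) (p.2.1, (p.2.2 : EuclideanSpace ℝ (Fin (l + 1))))) := by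
  have h : (fun p : DiscreteIndex ι × (((Metric.sphere (0 : EuclideanSpace ℝ (Fin (k + 1))) 1)) × ↥(ball (0 : EuclideanSpace ℝ (Fin (l + 1))) 1)) ↦
      ν.toFun (DiscreteIndex.mk.symm p.1) (p.2.1, (p.2.2 : EuclideanSpace ℝ (Fin (l + 1))))) =
      (fun p : DiscreteIndex ι × (((Metric.sphere (0 : EuclideanSpace ℝ (Fin (k + 1))) 1)) × (EuclideanSpace ℝ (Fin (l + 1)))) ↦ ν.toFun (DiscreteIndex.mk.symm p.1) p.2) ∘
        Prod.map id (Prod.map id (Subtype.val : ↥(ball (0 : EuclideanSpace ℝ (Fin (l + 1))) 1) → EuclideanSpace ℝ (Fin (l + 1)))) := by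
    funext p; rfl
  rw [h]
  exact ν.isOpenEmbedding_tubes.comp (IsOpenEmbedding.id.prodMap
    (IsOpenEmbedding.id.prodMap isOpen_ball.isOpenEmbedding_subtypeVal))

/-- **`Hₙ` of the handles `ι × OD^{k+1} × Sˡ` vanishes for `0 < n ≠ l`** (additivity over the
index, Hatcher Prop. 2.6, and `OD^{k+1} × Sˡ ≃ Sˡ`). [cite: HatcherAT2002, Prop. 2.6 and Cor. 2.14] -/
theorem isZero_singularHomology_ballTimesSphere_of_ne {n : ℕ} (hn0 : n ≠ 0) (hnl : n ≠ l) :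
    IsZero (singularHomology R M ↥(ballTimesSphere ι k l) n) := by
  let c : C(↥(ballTimesSphere ι k l), DiscreteIndex ι) :=
    ⟨fun b ↦ b.1.1, continuous_fst.comp continuous_subtype_val⟩
  have hpart := IsClopenPartition.ofContinuous c
  have hpiece : ∀ i : DiscreteIndex ι, IsZero (singularHomology R M ↥(c ⁻¹' {i}) n) := by
    intro i
    -- the slice over `i` is `OD^{k+1} × Sˡ`
    let e : ↥(c ⁻¹' {i}) ≃ₜ (↥(ball (0 : EuclideanSpace ℝ (Fin (k + 1))) 1) × ((Metric.sphere (0 : EuclideanSpace ℝ (Fin (l + 1))) 1))) :=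
      { toFun := fun b ↦ (⟨b.1.1.2.1, mem_ball_zero_iff.2 b.1.2⟩, b.1.1.2.2)
        invFun := fun q ↦ ⟨⟨(i, ((q.1 : EuclideanSpace ℝ (Fin (k + 1))), q.2)), mem_ball_zero_iff.1 q.1.2⟩, rfl⟩
        left_inv := fun b ↦ by
          obtain ⟨⟨⟨j, y, v⟩, hb⟩, hj⟩ := b
          change j = i at hj
          subst hj
          rfl
        right_inv := fun _ ↦ rfl
        continuous_toFun :=
          ((continuous_fst.comp (continuous_snd.comp (continuous_subtype_val.comp
            continuous_subtype_val))).subtype_mk _).prodMk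
            (continuous_snd.comp (continuous_snd.comp (continuous_subtype_val.comp
              continuous_subtype_val)))
        continuous_invFun := ((continuous_const.prodMk ((continuous_subtype_val.comp
          continuous_fst).prodMk continuous_snd)).subtype_mk _).subtype_mk _ }
    exact (isZero_singularHomology_ballProdSphere R M hn0 hnl).of_iso (singularHomology.mapIso R M e n)
  rw [ModuleCat.isZero_iff_subsingleton]
  refine ⟨fun y y' ↦ ?_⟩
  suffices h : ∀ y : singularHomology R M ↥(ballTimesSphere ι k l) n, y = 0 by rw [h y, h y']
  intro y
  obtain ⟨S, x, rfl⟩ := singularHomology.exists_eq_sum_map_subsetIncl (R := R) (M := M) hpart n y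
  refine Finset.sum_eq_zero fun i _ ↦ ?_
  haveI := ModuleCat.subsingleton_of_isZero (hpiece i)
  rw [Subsingleton.elim (x i) 0, map_zero]

end FramedSphereFamily

end Family

/-! ### §3 A surgery gluing `P = jA(X ∖ cores) ∪ jB(ι × OD^{k+1} × Sˡ)`: cores and cocores -/

section Gluing

variable {EX HX : Type*} [NormedAddCommGroup EX] [NormedSpace ℝ EX] [TopologicalSpace HX]
  {IX : ModelWithCorners ℝ EX HX} {X : Type} [TopologicalSpace X] [ChartedSpace HX X] [T2Space X]
  {ι : Type} [Finite ι] {k l : ℕ} (ν : FramedSphereFamily IX X ι k (l + 1))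
  {P : Type} [TopologicalSpace P] {jA : ↥(ν.coresᶜ) → P} {jB : ↥(ballTimesSphere ι k l) → P}

namespace FramedSphereFamily

/-! #### The `X` side: local homology at the cores -/

/-- **`H_q(X | cores; M) = 0` for `q < l + 1`** (the codimension of the cores): each core has the
product neighbourhood `φᵢ : Sᵏ × ℝˡ⁺¹ ↪ X` (`isZero_localHomologyOfSet_sphereCore`,
Kosinski X.1.1) and the cores are disjoint. [cite: Kosinski1993, Ch. X §1, Prop. 1.1] -/
theorem isZero_localHomologyOfSet_cores {q : ℕ} (hq : q < l + 1) :
    IsZero (localHomologyOfSet R M X ν.cores q) := by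
  haveI := Fintype.ofFinite ι
  rw [cores_eq_iUnion]
  exact isZero_localHomologyOfSet_iUnion_of_disjoint R M _
    (fun i ↦ ((isCompact_univ.prod isCompact_singleton).image (ν.continuous i)).isClosed)
    ν.pairwise_disjoint_image_core q
    fun i ↦ isZero_localHomologyOfSet_sphereCore R M (ν.isOpenEmbedding_toFun i) hq

/-- **`H_q(X ∖ cores) ≅ H_q(X)` for `q + 1 < l + 1`.** [cite: Kosinski1993, Ch. X §1, Prop. 1.1] -/
theorem isIso_map_subsetIncl_compl_cores {q : ℕ} (hq : q + 1 < l + 1) :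
    IsIso (singularHomology.map R M (subsetIncl ν.coresᶜ) q) :=
  isIso_map_subsetIncl_compl_of_isZero R M (ν.isZero_localHomologyOfSet_cores R M (by omega))
    (ν.isZero_localHomologyOfSet_cores R M hq)

omit [T2Space X] [Finite ι] in
/-- **Primitivity kills `H_l(X ∖ cores)`** (Kervaire–Milnor 1963, p. 527: "since `μᵣ · λᵣ = 1`
it follows that `H_{k-1} M₀ = 0`"): if `H_l(X; M) = 0` and `H_{l+1}(X) → H_{l+1}(X | cores)` is
onto, then `H_l(X ∖ cores; M) = 0` (exactness of
`H_{l+1}(X) → H_{l+1}(X | cores) →∂ H_l(X ∖ cores) → H_l(X)`).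
[cite: KervaireMilnorAnnals1963, Lemma 7.1 (proof, p. 527)] -/
theorem isZero_singularHomology_compl_cores_of_surjective
    (hX : IsZero (singularHomology R M X l))
    (hsurj : Function.Surjective (singularHomology.toLocalOfSet R M X ν.cores (l + 1))) :
    IsZero (singularHomology R M ↥(ν.coresᶜ) l) := by
  -- `∂ = 0` since `j_*` is onto and `∂ ∘ j_* = 0`
  have hδ : relativeSingularHomology.δ R M X ν.coresᶜ l = 0 := by
    ext w
    obtain ⟨x, rfl⟩ := hsurj w
    change (singularHomology.toLocalOfSet R M X ν.cores (l + 1) ≫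
      relativeSingularHomology.δ R M X ν.coresᶜ l) x = 0
    rw [singularHomology.toLocalOfSet, relativeSingularHomology.ofAbsolute_comp_δ]
    rfl
  haveI : Mono (singularHomology.map R M (subsetIncl ν.coresᶜ) l) :=
    (relativeSingularHomology.exact_δ_map R M ν.coresᶜ l).mono_g hδ
  exact IsZero.of_mono (singularHomology.map R M (subsetIncl ν.coresᶜ) l) hX

/-! #### The `P` side: the cocores and their product neighbourhoods -/

variable {ν}

omit [T2Space X] [Finite ι] in
/-- **The cocore tubes.** For the handle embedding `jB` there are maps `ψᵢ : Sˡ × ℝᵏ⁺¹ → P`,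
`(u, z) ↦ jB(i, β z, u)` with `β : ℝᵏ⁺¹ ≅ OD^{k+1}` the standard contraction — open embeddings
with pairwise disjoint ranges, product neighbourhoods of the cocore spheres `jB(i, 0, Sˡ)` of the
surgered space (`ψᵢ(u, 0) = jB(i, 0, u)`). [cite: MilnorHCobordism1965, Def. 3.11 (PDF p. 17)] -/
theorem exists_coTubes (hB : IsOpenEmbedding jB) :
    ∃ ψ : ι → ((Metric.sphere (0 : EuclideanSpace ℝ (Fin (l + 1))) 1)) × (EuclideanSpace ℝ (Fin (k + 1))) → P, (∀ i, IsOpenEmbedding (ψ i)) ∧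
      Pairwise (Disjoint on fun i ↦ range (ψ i)) ∧
      ∀ i u, ψ i (u, 0) = jB ⟨(DiscreteIndex.mk i, (0 : EuclideanSpace ℝ (Fin (k + 1))), u), by simp⟩ := by
  -- the slice of the handles over `i` is `OD^{k+1} × Sˡ`, and `Sˡ × ℝᵏ⁺¹ ≅ OD^{k+1} × Sˡ`
  let e₀ : ∀ i : ι, ↥({b : ↥(ballTimesSphere ι k l) | b.1.1 = DiscreteIndex.mk i}) ≃ₜ
      (↥(ball (0 : EuclideanSpace ℝ (Fin (k + 1))) 1) × ((Metric.sphere (0 : EuclideanSpace ℝ (Fin (l + 1))) 1))) := fun i ↦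
    { toFun := fun b ↦ (⟨b.1.1.2.1, mem_ball_zero_iff.2 b.1.2⟩, b.1.1.2.2)
      invFun := fun q ↦ ⟨⟨(DiscreteIndex.mk i, ((q.1 : EuclideanSpace ℝ (Fin (k + 1))), q.2)), mem_ball_zero_iff.1 q.1.2⟩,
        rfl⟩
      left_inv := fun b ↦ by
        obtain ⟨⟨⟨j, y, v⟩, hb⟩, hj⟩ := b
        have hj' : j = DiscreteIndex.mk i := hj
        subst hj'
        rfl
      right_inv := fun _ ↦ rfl
      continuous_toFun :=
        ((continuous_fst.comp (continuous_snd.comp (continuous_subtype_val.comp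
          continuous_subtype_val))).subtype_mk _).prodMk
          (continuous_snd.comp (continuous_snd.comp (continuous_subtype_val.comp
            continuous_subtype_val)))
      continuous_invFun := ((continuous_const.prodMk ((continuous_subtype_val.comp
        continuous_fst).prodMk continuous_snd)).subtype_mk _).subtype_mk _ }
  let e : ∀ i : ι, (((Metric.sphere (0 : EuclideanSpace ℝ (Fin (l + 1))) 1)) × (EuclideanSpace ℝ (Fin (k + 1)))) ≃ₜ
      ↥({b : ↥(ballTimesSphere ι k l) | b.1.1 = DiscreteIndex.mk i}) := fun i ↦
    ((Homeomorph.prodComm ((Metric.sphere (0 : EuclideanSpace ℝ (Fin (l + 1))) 1)) (EuclideanSpace ℝ (Fin (k + 1)))).trans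
      ((Homeomorph.unitBall (E := EuclideanSpace ℝ (Fin (k + 1)))).prodCongr (Homeomorph.refl ((Metric.sphere (0 : EuclideanSpace ℝ (Fin (l + 1))) 1))))).trans (e₀ i).symm
  refine ⟨fun i ↦ jB ∘ Subtype.val ∘ e i, fun i ↦ ?_, ?_, fun i u ↦ ?_⟩
  · have hopen : IsOpen {b : ↥(ballTimesSphere ι k l) | b.1.1 = DiscreteIndex.mk i} :=
      (isOpen_discrete {DiscreteIndex.mk i}).preimage (continuous_fst.comp continuous_subtype_val)
    exact hB.comp (hopen.isOpenEmbedding_subtypeVal.comp (e i).isOpenEmbedding)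
  · intro i j hij
    refine disjoint_left.2 ?_
    rintro _ ⟨q, rfl⟩ ⟨q', hq'⟩
    have h := congrArg (fun b : ↥(ballTimesSphere ι k l) ↦ b.1.1) (hB.injective hq')
    have h' : DiscreteIndex.mk j = DiscreteIndex.mk i := by
      rw [← (e j q').2, ← (e i q).2]; exact h
    exact hij (DiscreteIndex.mk.injective h').symm
  · have h0 : ((e i (u, 0)).1 : ↥(ballTimesSphere ι k l)) =
        ⟨(DiscreteIndex.mk i, (0 : EuclideanSpace ℝ (Fin (k + 1))), u), by simp⟩ := by
      apply Subtype.ext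
      show (DiscreteIndex.mk i, (((Homeomorph.unitBall (0 : EuclideanSpace ℝ (Fin (k + 1))) :
        ↥(ball (0 : EuclideanSpace ℝ (Fin (k + 1))) 1)) : EuclideanSpace ℝ (Fin (k + 1))), u)) = (DiscreteIndex.mk i, (0 : EuclideanSpace ℝ (Fin (k + 1))), u)
      rw [Homeomorph.coe_unitBall_apply_zero]
    show jB (e i (u, 0)).1 = _
    rw [h0]

omit [TopologicalSpace P] in
/-- **The complement of the cocores is `jA(X ∖ cores)`**: a point `jB(i, y, u)` lies in the
image of `X ∖ cores` iff `y ≠ 0` (Milnor's identification only concerns `0 < ‖y‖ < 1`); here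
for any family of maps `ψᵢ` with `ψᵢ(u, 0) = jB(i, 0, u)`.
[cite: MilnorHCobordism1965, Def. 3.11 (PDF p. 17)] -/
theorem compl_iUnion_coCore_eq_range (hcov : range jA ∪ range jB = univ)
    (hrel : ∀ a b, jA a = jB b ↔ sphereFamilySurgeryRel ν a b)
    {ψ : ι → ((Metric.sphere (0 : EuclideanSpace ℝ (Fin (l + 1))) 1)) × (EuclideanSpace ℝ (Fin (k + 1))) → P}
    (hψ0 : ∀ i u, ψ i (u, 0) = jB ⟨(DiscreteIndex.mk i, (0 : EuclideanSpace ℝ (Fin (k + 1))), u), by simp⟩) :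
    (⋃ i, ψ i '' (univ ×ˢ ({0} : Set (EuclideanSpace ℝ (Fin (k + 1))))))ᶜ = range jA := by
  -- `jB b ∈ range jA ↔ b.y ≠ 0`
  have key : ∀ b : ↥(ballTimesSphere ι k l), jB b ∈ range jA ↔ b.1.2.1 ≠ 0 := by
    intro b
    constructor
    · rintro ⟨a, ha⟩ h0
      obtain ⟨v, θ, hθ, hy, -⟩ := (hrel a b).1 ha
      rw [h0] at hy
      exact smul_ne_zero hθ.1.ne' (ne_zero_of_mem_unit_sphere v) hy.symm
    · intro hb
      obtain ⟨⟨j, y, u⟩, hb1⟩ := b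
      change y ≠ 0 at hb
      have hypos : 0 < ‖y‖ := norm_pos_iff.2 hb
      have hy1 : ‖y‖ < 1 := hb1
      let v : (Metric.sphere (0 : EuclideanSpace ℝ (Fin (k + 1))) 1) := radialProjection (spherePt k) y
      let a : ↥(ν.coresᶜ) := ⟨ν.toFun (DiscreteIndex.mk.symm j) (v, ‖y‖ • (u : EuclideanSpace ℝ (Fin (l + 1)))),
        ν.apply_mem_complement _ v (smul_ne_zero hypos.ne' (ne_zero_of_mem_unit_sphere u))⟩
      refine ⟨a, (hrel a _).2 ⟨v, ‖y‖, ⟨hypos, hy1⟩, ?_, rfl⟩⟩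
      exact (norm_smul_coe_radialProjection (spherePt k) y).symm
  ext x
  rw [mem_compl_iff, mem_iUnion, not_exists]
  constructor
  · intro hx
    by_contra hxA
    have hxB : x ∈ range jB := by
      have := hcov.symm ▸ mem_univ x
      exact this.resolve_left hxA
    obtain ⟨b, rfl⟩ := hxB
    have hb0 : b.1.2.1 = 0 := by
      by_contra h; exact hxA ((key b).2 h)
    apply hx (DiscreteIndex.mk.symm b.1.1)
    refine ⟨(b.1.2.2, 0), ⟨mem_univ _, rfl⟩, ?_⟩
    rw [hψ0]
    congr 1
    obtain ⟨⟨j, y, u⟩, hb1⟩ := b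
    change y = 0 at hb0
    subst hb0
    apply Subtype.ext
    show (DiscreteIndex.mk (DiscreteIndex.mk.symm j), (0 : EuclideanSpace ℝ (Fin (k + 1))), u) = (j, 0, u)
    rw [Equiv.apply_symm_apply]
  · rintro ⟨a, rfl⟩ i ⟨⟨u, z⟩, ⟨-, hz⟩, he⟩
    rw [mem_singleton_iff] at hz
    subst hz
    rw [hψ0] at he
    exact ((key _).1 ⟨a, he.symm⟩) rfl

variable (hA : IsOpenEmbedding jA) (hB : IsOpenEmbedding jB) (hcov : range jA ∪ range jB = univ)
  (hrel : ∀ a b, jA a = jB b ↔ sphereFamilySurgeryRel ν a b)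

omit [T2Space X] [Finite ι] in
/-- **`H_q(P | ⋃ cores of ψ; M) = 0` for `q < k + 1`** for finitely many open embeddings
`ψᵢ : Sˡ × ℝᵏ⁺¹ → P` with disjoint ranges (the cocore tubes: `k + 1` is the codimension of the
cocores in `P`). [cite: Kosinski1993, Ch. X §1, Prop. 1.1] -/
theorem isZero_localHomologyOfSet_coCores [T2Space P] [Finite ι] {ψ : ι → ((Metric.sphere (0 : EuclideanSpace ℝ (Fin (l + 1))) 1)) × (EuclideanSpace ℝ (Fin (k + 1))) → P}
    (hψ : ∀ i, IsOpenEmbedding (ψ i)) (hdisj : Pairwise (Disjoint on fun i ↦ range (ψ i)))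
    {q : ℕ} (hq : q < k + 1) :
    IsZero (localHomologyOfSet R M P (⋃ i, ψ i '' (univ ×ˢ ({0} : Set (EuclideanSpace ℝ (Fin (k + 1)))))) q) := by
  haveI := Fintype.ofFinite ι
  exact isZero_localHomologyOfSet_iUnion_of_disjoint R M _
    (fun i ↦ ((isCompact_univ.prod isCompact_singleton).image (hψ i).continuous).isClosed)
    (fun i j hij ↦ (hdisj hij).mono (image_subset_range _ _) (image_subset_range _ _)) q
    fun i ↦ isZero_localHomologyOfSet_sphereCore R M (hψ i) hq

include hA hB hcov hrel in
/-- **`(jA)_* : H_q(X ∖ cores) → H_q(P)` is an isomorphism for `q + 1 < k + 1`** (`P ∖ cocores =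
jA(X ∖ cores)` and the local homology at the cocores vanishes below their codimension `k + 1`).
[cite: Kosinski1993, Ch. X §1, Prop. 1.1] -/
theorem isIso_map_jA_of_lt [T2Space P] {q : ℕ} (hq : q + 1 < k + 1) :
    IsIso (singularHomology.map R M ⟨jA, hA.continuous⟩ q) := by
  obtain ⟨ψ, hψ, hdisj, hψ0⟩ := exists_coTubes (ι := ι) (k := k) (l := l) hB
  have h := isIso_map_subsetIncl_compl_of_isZero R M
    (isZero_localHomologyOfSet_coCores R M hψ hdisj (q := q) (by omega))
    (isZero_localHomologyOfSet_coCores R M hψ hdisj hq)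
  rw [compl_iUnion_coCore_eq_range hcov hrel hψ0] at h
  have hfac : singularHomology.map R M ⟨jA, hA.continuous⟩ q =
      (singularHomology.mapIso R M hA.isEmbedding.toHomeomorph q).hom ≫
        singularHomology.map R M (subsetIncl (range jA)) q := by
    rw [singularHomology.mapIso_hom, ← singularHomology.map_comp]
    rfl
  rw [hfac]
  infer_instance

include hA hB hcov hrel in
/-- **`(jA)_* : H_k(X ∖ cores) → H_k(P)` is onto** in the degree `k` one below the codimension of
the cocores (Kervaire–Milnor 1963, p. 527: "`H_k M'` is isomorphic to a quotient group of
`H_k M₀`"). [cite: KervaireMilnorAnnals1963, Lemma 7.1 (proof, p. 527)] -/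
theorem epi_map_jA_codim [T2Space P] : Epi (singularHomology.map R M ⟨jA, hA.continuous⟩ k) := by
  obtain ⟨ψ, hψ, hdisj, hψ0⟩ := exists_coTubes (ι := ι) (k := k) (l := l) hB
  have h := epi_map_subsetIncl_compl_of_isZero R M
    (isZero_localHomologyOfSet_coCores R M hψ hdisj (q := k) (by omega))
  rw [compl_iUnion_coCore_eq_range hcov hrel hψ0] at h
  exact epi_map_of_conj R M (subsetIncl (range jA)) ⟨jA, hA.continuous⟩
    hA.isEmbedding.toHomeomorph.symm (Homeomorph.refl P)
    (fun x ↦ by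
      obtain ⟨x, rfl⟩ := hA.isEmbedding.toHomeomorph.surjective x
      rw [Homeomorph.symm_apply_apply]; rfl) k h

end FramedSphereFamily

end Gluing

/-! ### §4 The middle dimension: surgery on a primitive isotropic family (`k = l + 1`) -/

section Middle

variable {EX HX : Type*} [NormedAddCommGroup EX] [NormedSpace ℝ EX] [TopologicalSpace HX]
  {IX : ModelWithCorners ℝ EX HX} {X : Type} [TopologicalSpace X] [ChartedSpace HX X] [T2Space X]
  {ι : Type} [Finite ι] {l : ℕ} {ν : FramedSphereFamily IX X ι (l + 1) (l + 1)}
  {P : Type} [TopologicalSpace P] [T2Space P]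
  {jA : ↥(ν.coresᶜ) → P} {jB : ↥(ballTimesSphere ι (l + 1) l) → P}
  (hA : IsOpenEmbedding jA) (hB : IsOpenEmbedding jB) (hcov : range jA ∪ range jB = univ)
  (hrel : ∀ a b, jA a = jB b ↔ sphereFamilySurgeryRel ν a b)

namespace FramedSphereFamily

include hA hB hcov hrel in
/-- **Surgery on a primitive isotropic family kills the middle homology** (Kervaire–Milnor 1963,
proof of Lemma 7.1, p. 527, for the simultaneous surgery along `r` disjoint framed
`(l+1)`-spheres `Sᵢ` in `X` of dimension `2l + 2`; Kosinski 1993, X.3, proof of (3.4)). Let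
`P = jA(X ∖ ⋃ Sᵢ) ∪ jB(ι × OD^{l+2} × Sˡ)` be glued along Milnor's identification. Suppose
(**isotropy**, "`λᵢ · λⱼ = 0`" for a basis `{λᵢ, μⱼ}` with `λᵢ · μⱼ = δᵢⱼ`: the classes meeting no
sphere are combinations of the spheres) that the kernel of `H_{l+1}(X) → H_{l+1}(X | ⋃ Sᵢ)` lies
in the span of the classes `(Sᵢ)_* H_{l+1}(S^{l+1})`. Then `H_{l+1}(P; M) = 0`.

Proof ("`H_k M'` is isomorphic to a quotient group of `H_k M₀` … each `λ'ᵢ` corresponds to a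
coset `λᵢ + λᵣ Z`"): `(jA)_* : H_{l+1}(X ∖ ⋃ Sᵢ) → H_{l+1}(P)` is onto (the cocores have
codimension `l + 2`); for `z ∈ H_{l+1}(X ∖ ⋃ Sᵢ)` its image in `X` meets no sphere, hence is a
combination of sphere classes, which lift to parallel spheres in the punctured unit tubes; the
difference dies in `X`, hence comes from `H_{l+2}(X | ⋃ Sᵢ) ≅ H_{l+2}(O | K₀)` for the unit
tube model `O = ι × S^{l+1} × Bˡ⁺¹ → X` (excision along an open embedding and naturality of `∂`),
i.e. again from the punctured unit tubes `O ∖ K₀`; and these map into the handles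
`ι × OD^{l+2} × Sˡ` by Milnor's identification, where `H_{l+1}` vanishes. No Künneth formula,
Thom class or duality is used.
[cite: KervaireMilnorAnnals1963, Lemma 7.1 (proof, pp. 527–528)] [cite: Kosinski1993, Ch. X §3, Thm. (3.4) (proof)] -/
theorem isZero_singularHomology_of_surgery_middle
    (hker : ∀ x : singularHomology R M X (l + 1),
      singularHomology.toLocalOfSet R M X ν.cores (l + 1) x = 0 →
        x ∈ Submodule.span R (⋃ i, Set.range
          (singularHomology.map R M ⟨ν.sphere i, ν.continuous_sphere i⟩ (l + 1)))) :
    IsZero (singularHomology R M P (l + 1)) := by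
  -- §a The unit tube model `O = ι × S^{l+1} × Bˡ⁺¹ → X`, its core `K₀` and `O ∖ K₀ → X ∖ cores`
  let O : Type := DiscreteIndex ι × (((Metric.sphere (0 : EuclideanSpace ℝ (Fin (l + 1 + 1))) 1)) × ↥(ball (0 : EuclideanSpace ℝ (Fin (l + 1))) 1))
  let Φ : O → X := fun p ↦ ν.toFun (DiscreteIndex.mk.symm p.1) (p.2.1, (p.2.2 : EuclideanSpace ℝ (Fin (l + 1))))
  have hΦ : IsOpenEmbedding Φ := ν.isOpenEmbedding_unitTubes
  let K₀ : Set O := {p | (p.2.2 : EuclideanSpace ℝ (Fin (l + 1))) = 0}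
  have hK₀ : Φ '' K₀ = ν.cores := by
    ext x
    rw [mem_cores_iff]
    constructor
    · rintro ⟨⟨i, u, w⟩, hp, rfl⟩
      have hp' : (w : EuclideanSpace ℝ (Fin (l + 1))) = 0 := hp
      exact ⟨DiscreteIndex.mk.symm i, u, by simp only [Φ, sphere_apply, hp']⟩
    · rintro ⟨i, v, rfl⟩
      refine ⟨(DiscreteIndex.mk i, v, ⟨0, mem_ball_self one_pos⟩), rfl, ?_⟩
      simp only [Φ, sphere_apply, Equiv.symm_apply_apply]
  have hmaps : Set.MapsTo Φ K₀ᶜ ν.coresᶜ := by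
    intro p hp hx
    rw [← hK₀] at hx
    obtain ⟨p', hp', he⟩ := hx
    exact hp (hΦ.injective he ▸ hp')
  let Φc : C(O, X) := ⟨Φ, hΦ.continuous⟩
  let τ₀ : C(↥K₀ᶜ, ↥(ν.coresᶜ)) := subsetRestrict Φc hmaps
  -- the three maps on `H_{l+1}`
  let ιX := singularHomology.map R M (subsetIncl ν.coresᶜ) (l + 1)
  let jP := singularHomology.map R M (⟨jA, hA.continuous⟩ : C(↥(ν.coresᶜ), P)) (l + 1)
  let τ := singularHomology.map R M τ₀ (l + 1)
  let V : Submodule R (singularHomology R M ↥(ν.coresᶜ) (l + 1)) := LinearMap.range τ.hom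
  -- §b (β) the punctured unit tubes die in `P`: `O ∖ K₀ → X ∖ cores → P` factors through the
  -- handles `ι × OD^{l+2} × Sˡ` by Milnor's identification `φᵢ(u, θ v) ∼ (i, θ u, v)`
  have hβ : ∀ w, jP (τ w) = 0 := by
    let G : C(↥K₀ᶜ, ↥(ballTimesSphere ι (l + 1) l)) :=
      { toFun := fun p ↦ ⟨(p.1.1, SphereSurgery.polar (p.1.2.1, (p.1.2.2 : EuclideanSpace ℝ (Fin (l + 1))))), by
          rw [mem_ballTimesSphere_iff, SphereSurgery.norm_polar_fst]
          exact mem_ball_zero_iff.1 p.1.2.2.2⟩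
        continuous_toFun := by
          refine Continuous.subtype_mk (Continuous.prodMk
            (continuous_fst.comp continuous_subtype_val) ?_) _
          have h1 : Continuous fun p : ↥K₀ᶜ ↦
              ((p.1.2.1, (p.1.2.2 : EuclideanSpace ℝ (Fin (l + 1)))) : ((Metric.sphere (0 : EuclideanSpace ℝ (Fin (l + 1 + 1))) 1)) × (EuclideanSpace ℝ (Fin (l + 1)))) :=
            ((continuous_fst.comp continuous_snd).prodMk
              (continuous_subtype_val.comp (continuous_snd.comp continuous_snd))).comp
              continuous_subtype_val
          exact SphereSurgery.continuousOn_polar.comp_continuous h1 fun p ↦ p.2 }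
    have hfac : (⟨jA, hA.continuous⟩ : C(↥(ν.coresᶜ), P)).comp τ₀ =
        (⟨jB, hB.continuous⟩ : C(_, P)).comp G := by
      ext p
      obtain ⟨⟨i, u, w⟩, hp⟩ := p
      have hw0 : (w : EuclideanSpace ℝ (Fin (l + 1))) ≠ 0 := hp
      have hwpos : 0 < ‖(w : EuclideanSpace ℝ (Fin (l + 1)))‖ := norm_pos_iff.2 hw0
      refine (hrel _ _).2 ⟨u, ‖(w : EuclideanSpace ℝ (Fin (l + 1)))‖, ⟨hwpos, mem_ball_zero_iff.1 w.2⟩, rfl, ?_⟩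
      show ν.toFun (DiscreteIndex.mk.symm i) (u, (w : EuclideanSpace ℝ (Fin (l + 1)))) =
        ν.toFun (DiscreteIndex.mk.symm i)
          (u, ‖(w : EuclideanSpace ℝ (Fin (l + 1)))‖ • (radialProjection (spherePt l) (w : EuclideanSpace ℝ (Fin (l + 1))) : EuclideanSpace ℝ (Fin (l + 1))))
      rw [norm_smul_coe_radialProjection]
    intro w
    rw [← ModuleCat.comp_apply]
    change (singularHomology.map R M τ₀ (l + 1) ≫ singularHomology.map R M
      (⟨jA, hA.continuous⟩ : C(↥(ν.coresᶜ), P)) (l + 1)) w = 0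
    rw [← singularHomology.map_comp, hfac, singularHomology.map_comp]
    have h0 : singularHomology.map R M G (l + 1) = 0 :=
      (isZero_singularHomology_ballTimesSphere_of_ne R M (ι := ι) (k := l + 1)
        (Nat.succ_ne_zero l) (Nat.succ_ne_self l)).eq_of_tgt _ _
    rw [h0, zero_comp]
    rfl
  -- §c (α) the kernel of `ιX` lies in `V`: exactness of `H_{l+2}(X | cores) →∂ H_{l+1}(X ∖ cores)
  -- → H_{l+1}(X)`, excision `H_{l+2}(O | K₀) ≅ H_{l+2}(X | cores)` and naturality of `∂`
  have hα : ∀ z, ιX z = 0 → z ∈ V := by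
    intro z hz
    have hex := relativeSingularHomology.exact_δ_map R M ν.coresᶜ (l + 1)
    rw [ShortComplex.moduleCat_exact_iff] at hex
    obtain ⟨y, hy⟩ := hex z hz
    have hK : IsClosed (Φ '' K₀) := by rw [hK₀]; exact ν.isClosed_cores
    have hmaps₁ : Set.MapsTo Φ K₀ᶜ (Φ '' K₀)ᶜ := by rw [hK₀]; exact hmaps
    have hiso₁ := isIso_relMap_of_isOpenEmbedding R M hΦ hK hmaps₁ (l + 1 + 1)
    have hiso : IsIso (relativeSingularHomology.map R M Φc hmaps (l + 1 + 1)) := by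
      revert hmaps₁
      rw [hK₀]
      exact fun _ h ↦ h
    obtain ⟨y', rfl⟩ := ((ModuleCat.epi_iff_surjective _).1 hiso.epi_of_iso) y
    refine ⟨relativeSingularHomology.δ R M O K₀ᶜ (l + 1) y', ?_⟩
    rw [← hy]
    change (relativeSingularHomology.δ R M O K₀ᶜ (l + 1) ≫ singularHomology.map R M τ₀ (l + 1)) y' = _
    rw [relativeSingularHomology.δ_naturality]
    rfl
  -- §d (γ) the sphere classes lie in `ιX(V)`: the core spheres are homotopic in `X` to parallel
  -- spheres `φᵢ(S^{l+1} × w₀)`, `w₀ ≠ 0`, which lie in the punctured unit tubes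
  have hγ : Submodule.span R (⋃ i, Set.range
      (singularHomology.map R M ⟨ν.sphere i, ν.continuous_sphere i⟩ (l + 1))) ≤ V.map ιX.hom := by
    rw [Submodule.span_le]
    rintro _ ⟨_, ⟨i, rfl⟩, ⟨t, rfl⟩⟩
    obtain ⟨w₀, hw₀⟩ : ∃ w₀ : ↥(ball (0 : EuclideanSpace ℝ (Fin (l + 1))) 1), (w₀ : EuclideanSpace ℝ (Fin (l + 1))) ≠ 0 :=
      ⟨⟨(2 : ℝ)⁻¹ • EuclideanSpace.single 0 1, by simp [norm_smul]; norm_num⟩, by simp⟩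
    let σ : C((Metric.sphere (0 : EuclideanSpace ℝ (Fin (l + 1 + 1))) 1), ↥K₀ᶜ) :=
      ⟨fun u ↦ ⟨(DiscreteIndex.mk i, u, w₀), hw₀⟩,
        ((continuous_const.prodMk (continuous_id.prodMk continuous_const)).subtype_mk _)⟩
    refine ⟨τ (singularHomology.map R M σ (l + 1) t), ⟨_, rfl⟩, ?_⟩
    change (singularHomology.map R M σ (l + 1) ≫ singularHomology.map R M τ₀ (l + 1) ≫
      singularHomology.map R M (subsetIncl ν.coresᶜ) (l + 1)) t = _
    rw [← singularHomology.map_comp, ← singularHomology.map_comp]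
    congr 2
    refine singularHomology.map_eq_of_homotopic R M ⟨?_⟩ (l + 1)
    exact
      { toFun := fun p ↦ ν.toFun i (p.2, (1 - (p.1 : ℝ)) • (w₀ : EuclideanSpace ℝ (Fin (l + 1))))
        continuous_toFun := (ν.continuous i).comp (continuous_snd.prodMk
          (((continuous_const.sub (continuous_subtype_val.comp continuous_fst))).smul
            continuous_const))
        map_zero_left := fun u ↦ by
          show ν.toFun i (u, (1 - 0 : ℝ) • (w₀ : EuclideanSpace ℝ (Fin (l + 1)))) = _
          rw [sub_zero, one_smul]
          rfl
        map_one_left := fun u ↦ by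
          show ν.toFun i (u, (1 - 1 : ℝ) • (w₀ : EuclideanSpace ℝ (Fin (l + 1)))) = ν.toFun i (u, 0)
          rw [sub_self, zero_smul] }
  -- §e conclusion: `jP` is onto, and `jP z = 0` for every `z`
  have hepi : Function.Surjective jP :=
    (ModuleCat.epi_iff_surjective _).1 (epi_map_jA_codim R M hA hB hcov hrel)
  rw [ModuleCat.isZero_iff_subsingleton]
  refine ⟨fun y y' ↦ ?_⟩
  suffices h : ∀ y : singularHomology R M P (l + 1), y = 0 by rw [h y, h y']
  intro y
  obtain ⟨z, rfl⟩ := hepi y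
  -- the image of `z` in `X` meets no sphere, hence is a combination of sphere classes
  have h0 : singularHomology.toLocalOfSet R M X ν.cores (l + 1) (ιX z) = 0 := by
    rw [← ModuleCat.comp_apply, singularHomology.toLocalOfSet,
      relativeSingularHomology.map_comp_ofAbsolute]
    rfl
  obtain ⟨v, hvV, hv⟩ := hγ (hker _ h0)
  -- `z - v ∈ ker ιX ⊆ V`, so `z ∈ V`
  have hzv : z - v ∈ V := hα _ (by rw [map_sub, sub_eq_zero]; exact hv.symm)
  have hz : z ∈ V := by simpa using V.add_mem hzv hvV
  obtain ⟨w, rfl⟩ := hz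
  exact hβ w

include hA hB hcov hrel in
/-- **Surgery on a primitive family keeps the homology below the middle dimension zero**
(Kervaire–Milnor 1963, p. 527: "`M₀` and `M'` are `(k-1)`-connected"): for `0 < q ≤ l`, if
`H_q(X; M) = 0` (and, for `q = l`, `H_{l+1}(X) → H_{l+1}(X | ⋃ Sᵢ)` is onto — **primitivity**,
"`λᵢ · μⱼ = δᵢⱼ`"), then `H_q(P; M) = 0` (`H_q(P) ≅ H_q(X ∖ ⋃ Sᵢ)`, which is `H_q(X)` for `q < l`
and vanishes by primitivity for `q = l`). [cite: KervaireMilnorAnnals1963, Lemma 7.1 (proof, p. 527)] -/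
theorem isZero_singularHomology_of_surgery_of_le {q : ℕ} (hql : q ≤ l)
    (hX : IsZero (singularHomology R M X q))
    (hsurj : Function.Surjective (singularHomology.toLocalOfSet R M X ν.cores (l + 1))) :
    IsZero (singularHomology R M P q) := by
  haveI := isIso_map_jA_of_lt R M hA hB hcov hrel (q := q) (by omega)
  have hX₀ : IsZero (singularHomology R M ↥(ν.coresᶜ) q) := by
    rcases hql.lt_or_eq with hlt | rfl
    · haveI := ν.isIso_map_subsetIncl_compl_cores R M (q := q) (by omega)
      exact hX.of_iso (asIso (singularHomology.map R M (subsetIncl ν.coresᶜ) q))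
    · exact ν.isZero_singularHomology_compl_cores_of_surjective R M hX hsurj
  exact hX₀.of_iso (asIso (singularHomology.map R M (⟨jA, hA.continuous⟩ :
    C(↥(ν.coresᶜ), P)) q)).symm

end FramedSphereFamily

end Middle

/-! ### §5 `π₁` and path-connectedness of a family surgery gluing -/

section PiOne

variable {EX HX : Type*} [NormedAddCommGroup EX] [NormedSpace ℝ EX] [TopologicalSpace HX]
  {IX : ModelWithCorners ℝ EX HX} {X : Type} [TopologicalSpace X] [ChartedSpace HX X] [T2Space X]
  {ι : Type} [Finite ι] {k l : ℕ} {ν : FramedSphereFamily IX X ι k (l + 1)}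
  {P : Type} [TopologicalSpace P] [T2Space P]
  {jA : ↥(ν.coresᶜ) → P} {jB : ↥(ballTimesSphere ι k l) → P}
  (hA : IsOpenEmbedding jA) (hB : IsOpenEmbedding jB) (hcov : range jA ∪ range jB = univ)
  (hrel : ∀ a b, jA a = jB b ↔ sphereFamilySurgeryRel ν a b)

namespace FramedSphereFamily

variable (ν) in
omit [T2Space P] in
/-- **`X ∖ ⋃ Sᵢ` is simply connected iff `X` is** (`l + 1 ≥ 3`, `k ≥ 1`): the cores have the
product neighbourhoods `Sᵏ × ℝˡ⁺¹` with simply connected punctured fibre.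
[cite: Kosinski1993, Ch. X §2, Thm. 2.2 (proof)] -/
theorem simplyConnectedSpace_compl_cores_iff [PathConnectedSpace X] (hk : 1 ≤ k) (hl : 2 ≤ l) :
    SimplyConnectedSpace ↥(ν.coresᶜ) ↔ SimplyConnectedSpace X := by
  haveI := Fintype.ofFinite ι
  haveI := pathConnectedSpace_sphere (n := k) (by omega)
  haveI := simplyConnectedSpace_compl_zero hl
  have h := simplyConnectedSpace_compl_iUnion_core_iff (W := X) (Z := (Metric.sphere (0 : EuclideanSpace ℝ (Fin (k + 1))) 1)) (E := EuclideanSpace ℝ (Fin (l + 1)))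
    ν.toFun ν.isOpenEmbedding_toFun ν.disjoint_range
  rwa [← cores_eq_iUnion] at h

omit [T2Space P] in
include hA hB hcov hrel in
/-- **A family surgery gluing of a space with path-connected `X ∖ ⋃ Sᵢ` is path connected**
(`l ≥ 1`): every handle slice `jB({i} × OD^{k+1} × Sˡ)` is path connected and meets
`jA(X ∖ ⋃ Sᵢ)`. [folklore] -/
theorem pathConnectedSpace_of_surgery_family [PathConnectedSpace ↥(ν.coresᶜ)] (hl : 1 ≤ l) :
    PathConnectedSpace P := by
  have hApc : IsPathConnected (range jA) :=
    isPathConnected_range (X := ↥(ν.coresᶜ)) hA.continuous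
  obtain ⟨a₀, ha₀⟩ := hApc.nonempty
  rw [pathConnectedSpace_iff_univ]
  refine ⟨a₀, mem_univ _, fun x _ ↦ ?_⟩
  rw [joinedIn_univ]
  by_cases hx : x ∈ range jA
  · exact (hApc.joinedIn a₀ ha₀ x hx).joined
  · have hxB : x ∈ range jB := (hcov.symm ▸ mem_univ x : x ∈ range jA ∪ range jB).resolve_left hx
    obtain ⟨b, rfl⟩ := hxB
    -- the handle slice through `b` is the image of `OD^{k+1} × Sˡ`
    haveI := pathConnectedSpace_sphere (n := l) (by omega)
    haveI : PathConnectedSpace ↥(ball (0 : EuclideanSpace ℝ (Fin (k + 1))) 1) :=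
      isPathConnected_iff_pathConnectedSpace.1 ((convex_ball _ _).isPathConnected
        ⟨0, mem_ball_self one_pos⟩)
    let g : (↥(ball (0 : EuclideanSpace ℝ (Fin (k + 1))) 1) × ((Metric.sphere (0 : EuclideanSpace ℝ (Fin (l + 1))) 1))) → ↥(ballTimesSphere ι k l) := fun q ↦
      ⟨(b.1.1, ((q.1 : EuclideanSpace ℝ (Fin (k + 1))), q.2)), mem_ball_zero_iff.1 q.1.2⟩
    have hg : Continuous g := (continuous_const.prodMk ((continuous_subtype_val.comp
      continuous_fst).prodMk continuous_snd)).subtype_mk _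
    have hslice : IsPathConnected (range (jB ∘ g)) := isPathConnected_range (hB.continuous.comp hg)
    -- a point of the slice in `range jA`
    let b₁ : ↥(ballTimesSphere ι k l) := ⟨(b.1.1, (2 : ℝ)⁻¹ • (spherePt k : EuclideanSpace ℝ (Fin (k + 1))), b.1.2.2), by
      rw [mem_ballTimesSphere_iff, norm_smul_coe_sphere (by norm_num)]; norm_num⟩
    have hb₁A : jB b₁ ∈ range jA := by
      -- Milnor's identification with `a = φᵢ(e₀, ½ u)`
      let a : ↥(ν.coresᶜ) := ⟨ν.toFun (DiscreteIndex.mk.symm b.1.1)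
        (spherePt k, (2 : ℝ)⁻¹ • (b.1.2.2 : EuclideanSpace ℝ (Fin (l + 1)))),
        ν.apply_mem_complement _ _ (smul_ne_zero (by norm_num) (ne_zero_of_mem_unit_sphere _))⟩
      exact ⟨a, (hrel a b₁).2 ⟨spherePt k, 2⁻¹, ⟨by norm_num, by norm_num⟩, rfl, rfl⟩⟩
    have hb₁g : jB b₁ ∈ range (jB ∘ g) :=
      ⟨(⟨(2 : ℝ)⁻¹ • (spherePt k : EuclideanSpace ℝ (Fin (k + 1))), by
        rw [mem_ball_zero_iff, norm_smul_coe_sphere (by norm_num)]; norm_num⟩, b.1.2.2), rfl⟩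
    have hbg : jB b ∈ range (jB ∘ g) := by
      refine ⟨(⟨b.1.2.1, mem_ball_zero_iff.2 b.2⟩, b.1.2.2), ?_⟩
      show jB _ = jB b
      congr 1
    have h1 : Joined a₀ (jB b₁) := (hApc.joinedIn a₀ ha₀ _ hb₁A).joined
    have h2 : Joined (jB b₁) (jB b) := (hslice.joinedIn _ hb₁g _ hbg).joined
    exact h1.trans h2

include hA hB hcov hrel in
/-- **A family surgery of index `k + 1 ≥ 3` with cospheres `Sˡ`, `l ≥ 2`, on a simply connected
space gives a simply connected space** (Kosinski 1993, X.2, proof of (2.2), for a disjoint family: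
`X ∖ ⋃ Sᵢ` is simply connected, and `P` is obtained from `P ∖ ⋃ S'ᵢ = jA(X ∖ ⋃ Sᵢ)` by putting
back the cocores `S'ᵢ ≅ Sˡ`, which have product neighbourhoods `Sˡ × ℝᵏ⁺¹`).
[cite: Kosinski1993, Ch. X §2, Thm. 2.2 (proof)] -/
theorem simplyConnectedSpace_of_surgery_family [SimplyConnectedSpace X] (hk : 2 ≤ k) (hl : 2 ≤ l) :
    SimplyConnectedSpace P := by
  haveI := Fintype.ofFinite ι
  haveI hX₀ : SimplyConnectedSpace ↥(ν.coresᶜ) :=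
    (ν.simplyConnectedSpace_compl_cores_iff (by omega) hl).2 inferInstance
  haveI : PathConnectedSpace P := pathConnectedSpace_of_surgery_family hA hB hcov hrel (by omega)
  obtain ⟨ψ, hψ, hdisj, hψ0⟩ := exists_coTubes (ι := ι) (k := k) (l := l) hB
  -- `range jA ≅ X ∖ cores` is simply connected
  have hA' : SimplyConnectedSpace ↥(range jA) :=
    (hA.isEmbedding.toHomeomorph (X := ↥(ν.coresᶜ))).toHomotopyEquiv.simplyConnectedSpace_iff.1 hX₀
  rw [← compl_iUnion_coCore_eq_range hcov hrel hψ0] at hA'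
  haveI := pathConnectedSpace_sphere (n := l) (by omega)
  haveI := simplyConnectedSpace_compl_zero (l := k) hk
  exact (simplyConnectedSpace_compl_iUnion_core_iff (W := P) (Z := (Metric.sphere (0 : EuclideanSpace ℝ (Fin (l + 1))) 1)) (E := EuclideanSpace ℝ (Fin (k + 1)))
    ψ hψ hdisj).1 hA'

end FramedSphereFamily

end PiOne

/-! ### §6 The surgered manifold `χ(X, φ₁, …, φᵣ)` of the tree -/

section Surgered

variable {n k l : ℕ} {X : Type} [TopologicalSpace X] [ChartedSpace (EuclideanHalfSpace (n + 1)) X]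
  [T2Space X] [IsManifold (𝓡∂ (n + 1)) ∞ X] {ι : Type} [Finite ι] [Nonempty ι]

namespace FramedSphereFamily

/-- The gluing maps of the surgered manifold of a finite framed family are open embeddings
covering it along Milnor's relation (the topological content of `isOpenGluingWith_surgered`).
[cite: MilnorHCobordism1965, Def. 3.11 (PDF p. 17), §3 (PDF p. 21)] -/
theorem surgered_gluing_family (ν : FramedSphereFamily (𝓡∂ (n + 1)) X ι k (l + 1))
    (hkl : k + l = n) :
    IsOpenEmbedding (ν.glueData hkl).inl ∧
      IsOpenEmbedding ((ν.glueData hkl).inr ∘ SphereSurgery.toHandle ι k l hkl) ∧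
      range (ν.glueData hkl).inl ∪ range ((ν.glueData hkl).inr ∘ SphereSurgery.toHandle ι k l hkl) =
        univ ∧
      ∀ a b, (ν.glueData hkl).inl a = ((ν.glueData hkl).inr ∘ SphereSurgery.toHandle ι k l hkl) b ↔
        sphereFamilySurgeryRel ν a b := by
  have h := ν.isOpenGluingWith_surgered hkl
  exact ⟨⟨h.1.isEmbedding, h.2.1⟩, ⟨h.2.2.1.isEmbedding, h.2.2.2.1⟩, h.2.2.2.2.1, h.2.2.2.2.2⟩

/-- **Kervaire–Milnor's Lemma 7.1, homological core, for the surgered manifold of the tree**: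
for a finite framed family `ν` of `(l+1)`-spheres with `(l+1)`-dimensional fibre in a compact
`(2l+2)`-manifold `X` with boundary, whose classes meeting no sphere
(`ker (H_{l+1}(X) → H_{l+1}(X | ⋃ Sᵢ))`) are combinations of the sphere classes,
`H_{l+1}(χ(X, ν); M) = 0`. [cite: KervaireMilnorAnnals1963, Lemma 7.1 (proof, pp. 527–528)] -/
theorem isZero_singularHomology_surgered_middle (ν : FramedSphereFamily (𝓡∂ (n + 1)) X ι (l + 1) (l + 1))
    (hkl : l + 1 + l = n)
    (hker : ∀ x : singularHomology R M X (l + 1),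
      singularHomology.toLocalOfSet R M X ν.cores (l + 1) x = 0 →
        x ∈ Submodule.span R (⋃ i, Set.range
          (singularHomology.map R M ⟨ν.sphere i, ν.continuous_sphere i⟩ (l + 1)))) :
    IsZero (singularHomology R M (ν.Surgered hkl) (l + 1)) := by
  obtain ⟨hA, hB, hcov, hrel⟩ := ν.surgered_gluing_family hkl
  exact isZero_singularHomology_of_surgery_middle R M hA hB hcov hrel hker

/-- **Kervaire–Milnor's Lemma 7.1, the degrees below the middle, for the surgered manifold of the
tree**: for `q ≤ l`, if `H_q(X; M) = 0` and `H_{l+1}(X) → H_{l+1}(X | ⋃ Sᵢ)` is onto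
(primitivity), then `H_q(χ(X, ν); M) = 0`. [cite: KervaireMilnorAnnals1963, Lemma 7.1 (proof, p. 527)] -/
theorem isZero_singularHomology_surgered_of_le (ν : FramedSphereFamily (𝓡∂ (n + 1)) X ι (l + 1) (l + 1))
    (hkl : l + 1 + l = n) {q : ℕ} (hql : q ≤ l) (hX : IsZero (singularHomology R M X q))
    (hsurj : Function.Surjective (singularHomology.toLocalOfSet R M X ν.cores (l + 1))) :
    IsZero (singularHomology R M (ν.Surgered hkl) q) := by
  obtain ⟨hA, hB, hcov, hrel⟩ := ν.surgered_gluing_family hkl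
  exact isZero_singularHomology_of_surgery_of_le R M hA hB hcov hrel hql hX hsurj

/-- **A finite family surgery of index `k + 1 ≥ 3` with cospheres `Sˡ`, `l ≥ 2`, keeps the
manifold simply connected.** [cite: Kosinski1993, Ch. X §2, Thm. 2.2 (proof)] -/
theorem simplyConnectedSpace_surgered_family [SimplyConnectedSpace X]
    (ν : FramedSphereFamily (𝓡∂ (n + 1)) X ι k (l + 1)) (hkl : k + l = n) (hk : 2 ≤ k)
    (hl : 2 ≤ l) : SimplyConnectedSpace (ν.Surgered hkl) := by
  obtain ⟨hA, hB, hcov, hrel⟩ := ν.surgered_gluing_family hkl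
  exact simplyConnectedSpace_of_surgery_family hA hB hcov hrel hk hl

end FramedSphereFamily

end Surgered

end Literature.Topology.FourManifolds

end
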